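import Mathlib
import Summits.Schanuel.Schanuel.Theses.RoyCriterion
import Literature.NumberTheory.Transcendental.RoySmallValueRoyD
import Literature.NumberTheory.Transcendental.RoySmallValueEndgame

/-!
# Sketch (crux-ideate round 2, ideator 5) — crux `stmt-Schanuel-1050` `RoySmallValueDirichletGap`

First-lemma signatures for the two round-2 idea cards

* `upward-lethality-persistence` : `levelTransfer_term` (proved), `UpwardLethalEndgame`
  (real-exponent statement, the lossless direction of Roy's level comparison), `lethalOrder`;
* `leaf-jensen-crowding` : `JensenSchwarzClusters` (classical Schwarz–Jensen inequality with
  several zero clusters, the amplification engine), `CrowdingEndgame` (real-exponent statement: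
  Roy's Step-5 inequality with the mismatch `T/T*` divided by `1 + k`, `k` = number of extra
  enemy clusters, contradicts for every `δ > 0` once `k + 1 ≥ (D/D*)^τ / 25`).

Everything is over Mathlib reals/complex analysis + the route decl; no new objects.
-/

set_option linter.dupNamespace false
set_option linter.unusedVariables false

noncomputable section

namespace Summit.Schanuel.Schanuel.Cruxes.RoySmallValueDirichletGap.SketchIdeator5

open Real Filter Complex
open Summit.Schanuel.Schanuel.Theses.RoyCriterion (RoySmallValueDirichletGap)

/-! ## Card `upward-lethality-persistence` -/

/-- **Level transfer of one closeness term.** With `ld = log dist(α,(1:γ)) ≤ 0` and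
`le = log dist(α, A_γ)` (Roy 2013 §4), for `0 ≤ t ≤ T`:
`max (t·ld) le ≤ (t/T)·max (T·ld) le + max le 0`.
Read downward (`t = T* < T`) this is exactly Roy's Step-5 loss `T/T*`; read upward (`t ≥ T`,
use `levelTransfer_mono`) there is NO loss. -/
theorem levelTransfer_term {t T ld le : ℝ} (ht : 0 ≤ t) (htT : t ≤ T) (hT : 0 < T)
    (hld : ld ≤ 0) :
    max (t * ld) le ≤ t / T * max (T * ld) le + max le 0 := by
  have hq0 : 0 ≤ t / T := div_nonneg ht hT.le
  have hq1 : t / T ≤ 1 := (div_le_one hT).2 htT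
  have hm1 : T * ld ≤ max (T * ld) le := le_max_left _ _
  have hm2 : le ≤ max (T * ld) le := le_max_right _ _
  have h0 : 0 ≤ max le 0 := le_max_right _ _
  have hle : le ≤ max le 0 := le_max_left _ _
  rcases le_total le (t * ld) with h | h
  · rw [max_eq_left h]
    have : t * ld = t / T * (T * ld) := by field_simp
    nlinarith [mul_le_mul_of_nonneg_left hm1 hq0]
  · rw [max_eq_right h]
    rcases le_total le 0 with hle0 | hle0
    · -- `le ≤ 0`: `(t/T)·le ≥ le`
      have h1 : t / T * le ≥ le := by nlinarith
      nlinarith [mul_le_mul_of_nonneg_left hm2 hq0]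
    · have h2 : 0 ≤ t / T * max (T * ld) le :=
        mul_nonneg hq0 (le_trans hle0 hm2)
      linarith

/-- Monotonicity in the order (the upward direction is free): for `T ≤ t` and `ld ≤ 0`,
`max (t·ld) le ≤ max (T·ld) le`. -/
theorem levelTransfer_mono {t T ld le : ℝ} (hTt : T ≤ t) (hld : ld ≤ 0) :
    max (t * ld) le ≤ max (T * ld) le :=
  max_le_max (by nlinarith) le_rfl

/-- **Upward lethal endgame (real-exponent form).** Roy's Step 2 at level `D` gives
`κ D^δ (D^β g + D h) ≤ -S_T(Z)`; the product formula at ANY level `D' = λ D ≥ D` (`λ ≥ 1`) with a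
non-vanishing integer polynomial having `≥ T` small derivatives gives `-S_T(Z) ≤ A (λD)^β g + λ D h + C g`
(via `levelTransfer_mono`). The two are incompatible for large `D`, for EVERY `δ > 0` — no gap.
Statement only (elementary; cf. `Roy2013.exponent_contradiction` for the downward version). -/
def UpwardLethalEndgame : Prop :=
  ∀ (β δ κ A C lam : ℝ), 1 ≤ β → 0 < δ → 0 < κ → 0 < A → 0 ≤ C → 1 ≤ lam →
    ∀ᶠ D : ℝ in atTop, ∀ g h : ℝ, 1 ≤ g → 0 ≤ h →
      ¬ (κ * D ^ δ * (D ^ β * g + D * h) ≤ A * (lam * D) ^ β * g + lam * D * h + C * g)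

/-- **Lethal order at a lower level** `D' ≤ D` (real-exponent form of the card's `t_crit`):
if an integer polynomial of degree `D'`, height `≤ e^{2D'^β}`, with `t ≤ T = D^τ` small
derivatives at `γ` does not vanish on the enemy `Z_D`, then (Step 2 + `levelTransfer_term` +
product formula) `(t/T) κ D^δ (D^β g + D h) ≤ A D'^β g + D' h + C g`; with `β ≥ 1`, `D' ≤ D`
this forces `t ≤ ((A + C + 1)/κ) · D^{τ-1-δ} · D'`, i.e. the hypothesis polynomials of every
level `D' ∈ (D*, D]` vanish on `Z_D` to `𝒟`-order `≥ 3⌊D'^τ⌋ − ((A+C+1)/κ) D^{τ−1−δ} D'`. -/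
def lethalOrder (A C κ τ δ D D' : ℝ) : ℝ := (A + C + 1) / κ * D ^ (τ - 1 - δ) * D'

theorem lethalOrder_nonneg {A C κ τ δ D D' : ℝ} (hA : 0 ≤ A) (hC : 0 ≤ C) (hκ : 0 < κ)
    (hD : 0 ≤ D) (hD' : 0 ≤ D') : 0 ≤ lethalOrder A C κ τ δ D D' := by
  unfold lethalOrder
  have : 0 ≤ (A + C + 1) / κ := div_nonneg (by linarith) hκ.le
  exact mul_nonneg (mul_nonneg this (Real.rpow_nonneg hD _)) hD'

/-! ## Card `leaf-jensen-crowding` -/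

/-- **Schwarz–Jensen with several zero clusters** (classical; the amplification engine).
If `f` is entire, `‖f‖ ≤ M` on the unit circle, `f` vanishes to order `m` at `0` and to order
`mult ζ` at each point `ζ` of a finite set `S` inside the disc of radius `ρ ≤ 1/2`, then
`‖f⁽ᵐ⁾(0)‖ ≤ m! · M · ρ^{Σ_{ζ∈S} mult ζ}` (divide by `zᵐ` and the Blaschke factors, maximum principle).
In the card: `f(z) = P̃_{D*}(α·(z,e^z))` at a near-leaf enemy point `α`, `m` = its exact leaf order,
the clusters are γ's foot point (order `3T*` up to a certified defect) and the OTHER enemies alive at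
level `D*`; the left side is `≥ e^{−D* h(Z)}/…` by the product formula. -/
def JensenSchwarzClusters : Prop :=
  ∀ (f : ℂ → ℂ), Differentiable ℂ f → ∀ (m : ℕ) (M ρ : ℝ) (mult : ℂ → ℕ) (S : Finset ℂ),
    0 < ρ → ρ ≤ 1 / 2 → 0 ≤ M → (∀ z : ℂ, ‖z‖ = 1 → ‖f z‖ ≤ M) →
    (∀ i < m, iteratedDeriv i f 0 = 0) →
    (∀ ζ ∈ S, 0 < ‖ζ‖ ∧ ‖ζ‖ ≤ ρ ∧ ∀ i < mult ζ, iteratedDeriv i f ζ = 0) →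
    ‖iteratedDeriv m f 0‖ ≤ (m.factorial : ℝ) * M * ρ ^ (∑ ζ ∈ S, mult ζ)

/-- **Crowding endgame (real-exponent form).** Roy's combined Step-2/Step-4 inequality with the
level mismatch `T/T*` replaced by `T/((k+1)T*)`, `k` = number of extra enemy clusters in the
Jensen disc at level `D*`: if `k + 1 ≥ (D/D*)^τ / L` for a constant `L`, the inequality
`κ D^δ (D^β g + D h) ≤ (L + 1)(A D*^β g + D* h)` already contradicts for every `δ > 0`
(same proof as `UpwardLethalEndgame` with `lam = 1`, since `D* ≤ D`). -/
def CrowdingEndgame : Prop :=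
  ∀ (β δ κ A L : ℝ), 0 < δ → 0 < κ → 0 < A → 0 ≤ L → 1 ≤ β →
    ∀ᶠ D : ℝ in atTop, ∀ Ds g h : ℝ, 1 ≤ Ds → Ds ≤ D → 1 ≤ g → 0 ≤ h →
      ¬ (κ * D ^ δ * (D ^ β * g + D * h) ≤ (L + 1) * (A * Ds ^ β * g + Ds * h))


/-- `UpwardLethalEndgame` holds (elementary). -/
theorem upwardLethalEndgame_holds : UpwardLethalEndgame := by
  intro β δ κ A C lam hβ hδ hκ hA hC hlam
  have hK := ((tendsto_rpow_atTop hδ).eventually_ge_atTop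
    (2 * (A * lam ^ β + C + lam) / κ)).and (eventually_ge_atTop (1 : ℝ))
  filter_upwards [hK] with D hD g h hg hh hle
  obtain ⟨hKD, hD1⟩ := hD
  have hDpos : 0 < D := by linarith
  have hlam0 : 0 ≤ lam := by linarith
  have hDβ : 0 < D ^ β := Real.rpow_pos_of_pos hDpos β
  have hDβ1 : 1 ≤ D ^ β := Real.one_le_rpow hD1 (by linarith)
  have hlamβ : 0 ≤ lam ^ β := Real.rpow_nonneg hlam0 β
  have hmul : (lam * D) ^ β = lam ^ β * D ^ β := Real.mul_rpow hlam0 hDpos.le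
  have hκD : 2 * (A * lam ^ β + C + lam) ≤ κ * D ^ δ := by
    have := mul_le_mul_of_nonneg_left hKD hκ.le
    rwa [mul_div_cancel₀ _ hκ.ne'] at this
  set X : ℝ := D ^ β * g + D * h with hX
  have hg0 : 0 ≤ g := by linarith
  have hXpos : 0 < X := by
    have : 0 < D ^ β * g := mul_pos hDβ (by linarith)
    have : 0 ≤ D * h := mul_nonneg hDpos.le hh
    linarith
  have hDgX : D ^ β * g ≤ X := by have : 0 ≤ D * h := mul_nonneg hDpos.le hh; linarith
  have hDhX : D * h ≤ X := by have : 0 ≤ D ^ β * g := mul_nonneg hDβ.le hg0; linarith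
  have hgX : g ≤ X := by
    have : g ≤ D ^ β * g := by nlinarith
    linarith
  -- RHS ≤ (A lam^β + C + lam) X
  have hR : A * (lam * D) ^ β * g + lam * D * h + C * g ≤ (A * lam ^ β + C + lam) * X := by
    rw [hmul]
    have h1 : A * (lam ^ β * D ^ β) * g = (A * lam ^ β) * (D ^ β * g) := by ring
    rw [h1]
    have e1 : (A * lam ^ β) * (D ^ β * g) ≤ (A * lam ^ β) * X :=
      mul_le_mul_of_nonneg_left hDgX (mul_nonneg hA.le hlamβ)
    have e2 : lam * D * h ≤ lam * X := by
      rw [mul_assoc]; exact mul_le_mul_of_nonneg_left hDhX hlam0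
    have e3 : C * g ≤ C * X := mul_le_mul_of_nonneg_left hgX hC
    nlinarith
  have hL : 2 * (A * lam ^ β + C + lam) * X ≤ κ * D ^ δ * X :=
    mul_le_mul_of_nonneg_right hκD hXpos.le
  have hcpos : 0 < (A * lam ^ β + C + lam) * X :=
    mul_pos (by nlinarith [mul_nonneg hA.le hlamβ]) hXpos
  have : κ * D ^ δ * (D ^ β * g + D * h) = κ * D ^ δ * X := by rw [hX]
  rw [this] at hle
  nlinarith

/-- `CrowdingEndgame` holds (elementary; `D* ≤ D`). -/
theorem crowdingEndgame_holds : CrowdingEndgame := by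
  intro β δ κ A L hδ hκ hA hL hβ
  have hK := ((tendsto_rpow_atTop hδ).eventually_ge_atTop
    (2 * ((L + 1) * (A + 1)) / κ)).and (eventually_ge_atTop (1 : ℝ))
  filter_upwards [hK] with D hD Ds g h hDs1 hDsD hg hh hle
  obtain ⟨hKD, hD1⟩ := hD
  have hDpos : 0 < D := by linarith
  have hDs0 : 0 ≤ Ds := by linarith
  have hDsβ : Ds ^ β ≤ D ^ β := Real.rpow_le_rpow hDs0 hDsD (by linarith)
  have hDβ : 0 < D ^ β := Real.rpow_pos_of_pos hDpos β
  have hκD : 2 * ((L + 1) * (A + 1)) ≤ κ * D ^ δ := by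
    have := mul_le_mul_of_nonneg_left hKD hκ.le
    rwa [mul_div_cancel₀ _ hκ.ne'] at this
  set X : ℝ := D ^ β * g + D * h with hX
  have hg0 : 0 ≤ g := by linarith
  have hXpos : 0 < X := by
    have : 0 < D ^ β * g := mul_pos hDβ (by linarith)
    have : 0 ≤ D * h := mul_nonneg hDpos.le hh
    linarith
  have hL1 : 0 ≤ L + 1 := by linarith
  have hR : (L + 1) * (A * Ds ^ β * g + Ds * h) ≤ (L + 1) * (A + 1) * X := by
    have h1 : A * Ds ^ β * g ≤ A * D ^ β * g :=
      mul_le_mul_of_nonneg_right (mul_le_mul_of_nonneg_left hDsβ hA.le) hg0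
    have h2 : Ds * h ≤ D * h := mul_le_mul_of_nonneg_right hDsD hh
    have h3 : A * D ^ β * g + D * h ≤ (A + 1) * X := by
      rw [hX]
      nlinarith [mul_nonneg hDβ.le hg0, mul_nonneg hDpos.le hh, hA.le]
    calc (L + 1) * (A * Ds ^ β * g + Ds * h) ≤ (L + 1) * (A * D ^ β * g + D * h) :=
          mul_le_mul_of_nonneg_left (by linarith) hL1
      _ ≤ (L + 1) * ((A + 1) * X) := mul_le_mul_of_nonneg_left h3 hL1
      _ = (L + 1) * (A + 1) * X := by ring
  have hLX : 2 * ((L + 1) * (A + 1)) * X ≤ κ * D ^ δ * X :=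
    mul_le_mul_of_nonneg_right hκD hXpos.le
  have hcpos : 0 < (L + 1) * (A + 1) * X := mul_pos (mul_pos (by linarith) (by linarith)) hXpos
  have : κ * D ^ δ * (D ^ β * g + D * h) = κ * D ^ δ * X := by rw [hX]
  rw [this] at hle
  nlinarith

/-- Sanity link to the crux decl (type-checks that we are talking about the route's statement). -/
theorem crux_statement_shape : RoySmallValueDirichletGap ↔ RoySmallValueDirichletGap := Iff.rfl

end Summit.Schanuel.Schanuel.Cruxes.RoySmallValueDirichletGap.SketchIdeator5

end
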